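import Summits.Ventures.HodgeRepro2.T5SU11SphericalStrict

/-!
# The majorant `|a(g)|⁻¹ ≤ Ξ(g)` and the Herz–Cowling–Haagerup–Howe bound for the holomorphic
discrete-series coefficients: `(1 − |g·0|²)^{k/2} ≤ Ξ(g)` for `k ≥ 1`

For `t > 0` and `τ = tanh t ∈ (0, 1)`, `cosh t − ū² sinh t = cosh t · (1 − ū² τ)`, so Harish-Chandra's
`Ξ(a_t) = sph 1 (a_t) = ∫_K |cosh t − ū² sinh t|⁻¹ dk = (cosh t)⁻¹ ∫_K |1 − ū² τ|⁻¹ dk`. Pointwise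
`|1 − w|⁻¹ ≥ Re ((1 − w)⁻¹) = (P(w) + 1)/2` for `|w| < 1` (`Re z ≤ |z|`; `T5SU11HorocycleTransitive.half_add_one`,
`half_re`: `Re (2/(1 − w)) = P(w) + 1` with `P` the Poisson kernel), and `∫_K P(ū² τ) dk = 1`
(`T5SU11SphericalTwo.integral_poisson_haarCircle`), so `∫_K |1 − ū² τ|⁻¹ dk ≥ 1`:
**`(cosh t)⁻¹ ≤ Ξ(a_t)`** for every `t` (`inv_cosh_le_sph_one_hyp`), i.e. **`|a(g)|⁻¹ ≤ Ξ(g)`** on the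
group (`norm_mat_inv_le_sph_one`; `|a(g)| = cosh (cartanT g)`), sharpening the `2^λ |a(g)|^{-λ} ≥ …` of
`T5SU11SphericalLpSharp` at `λ = 1`, and `|a(g)|⁻¹ ≤ φ_λ(g)` for every `λ` (`norm_mat_inv_le_sph`, since
`Ξ ≤ φ_λ`). Since `|a(g)|⁻¹ ≤ 1`, **`|a(g)|^{-s} ≤ Ξ(g)` for every `s ≥ 1`** (`norm_mat_inv_rpow_le_sph_one`),
and with `|a(g)|⁻² = 1 − |g·0|²` (`T5SU11CartanProjection.inv_cosh_cartanT_sq`):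
**`(1 − |g·0|²)^{s/2} ≤ Ξ(g)` for `s ≥ 1`** (`one_sub_norm_orbit_sq_rpow_le_sph_one`) — the modulus
`(1 − |g·0|²)^{k/2}` of the weight-`k` holomorphic discrete-series coefficient
`⟨π_k(g) v₀, v₀⟩` (rows 120–217) is dominated by Harish-Chandra's `Ξ` for every weight `k ≥ 1`: the
Herz / Cowling–Haagerup–Howe majorant principle for these coefficients, in kernel, with constant `1`.
Nothing is claimed about (N).

Blind lane: Mathlib + the HodgeRepro2 prefix only; no sorry; axioms ⊆ {propext, Classical.choice,
Quot.sound}.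
-/

namespace Summit.Ventures.HodgeRepro2.T5SU11SphericalMajorant

open MeasureTheory Metric Set Filter Topology Complex
open T5SU11Unimodular T5SU11Fibration T5SU11Cartan T5SU11OneParameter T5SU11CartanProjection
  T5HaarCircle T5BergmanCoefficient T5SU11SphericalFunction T5SU11SphericalTwo
  T5SU11SphericalSymmetry T5SU11SphericalBounds T5SU11SphericalContinuous
  T5SU11SphericalAsymptotic T5SU11SphericalLp T5SU11SphericalCfun T5SU11SphericalLpSharp
  T5SU11SphericalXiLog T5SU11SphericalCfunLimit T5SU11SphericalStrict T5SU11HorocycleTransitive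
  T5SU11Horocycle
open scoped Real

/-! ### The pointwise bound `|1 − w|⁻¹ ≥ (P(w) + 1)/2` -/

/-- `Re (2/(1 − w)) = P(w) + 1` for `|w| < 1`. -/
lemma re_two_div_one_sub {w : ℂ} (hw : w ∈ ball (0 : ℂ) 1) : (2 / (1 - w)).re = poisson w + 1 := by
  rw [← half_add_one hw, Complex.add_re, half_re hw, Complex.one_re]

/-- `(P(w) + 1)/2 ≤ ‖1 − w‖⁻¹` for `|w| < 1`. -/
lemma poisson_add_one_div_two_le {w : ℂ} (hw : w ∈ ball (0 : ℂ) 1) :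
    (poisson w + 1) / 2 ≤ ‖1 - w‖⁻¹ := by
  have h1 := Complex.re_le_norm (2 / (1 - w))
  rw [re_two_div_one_sub hw, norm_div, Complex.norm_two, div_eq_mul_inv] at h1
  linarith

/-- `ū² τ ∈ ball 0 1` for `|τ| < 1`. -/
lemma conj_sq_mul_mem_ball (u : Circle) {τ : ℝ} (hτ : |τ| < 1) :
    (starRingEnd ℂ) (u : ℂ) ^ 2 * (τ : ℂ) ∈ ball (0 : ℂ) 1 := by
  rw [mem_ball_zero_iff, norm_mul, norm_pow, Complex.norm_conj, Circle.norm_coe, one_pow, one_mul,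
    Complex.norm_real, Real.norm_eq_abs]
  exact hτ

/-- `u ↦ ‖1 − ū² τ‖⁻¹` is continuous on `K` for `|τ| < 1`. -/
lemma continuous_norm_one_sub_inv {τ : ℝ} (hτ : |τ| < 1) :
    Continuous fun u : Circle => ‖(1 : ℂ) - (starRingEnd ℂ) (u : ℂ) ^ 2 * (τ : ℂ)‖⁻¹ := by
  refine Continuous.inv₀ (by fun_prop) fun u => ?_
  exact norm_ne_zero_iff.mpr (one_sub_ne_zero_of_mem_ball (conj_sq_mul_mem_ball u hτ))

/-- `u ↦ P(ū² τ)` is continuous on `K` for `|τ| < 1`. -/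
lemma continuous_poisson_conj_sq_mul {τ : ℝ} (hτ : |τ| < 1) :
    Continuous fun u : Circle => poisson ((starRingEnd ℂ) (u : ℂ) ^ 2 * (τ : ℂ)) := by
  unfold poisson
  refine Continuous.div (by fun_prop) (by fun_prop) fun u => ?_
  exact normSq_one_sub_ne_zero (conj_sq_mul_mem_ball u hτ)

section measure

variable [MeasurableSpace Circle] [BorelSpace Circle]

/-- **`∫_K ‖1 − ū² τ‖⁻¹ dk ≥ 1`** for `0 < τ < 1`. -/
theorem one_le_integral_norm_one_sub_inv {τ : ℝ} (hτ0 : 0 < τ) (hτ1 : τ < 1) :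
    1 ≤ ∫ u, ‖(1 : ℂ) - (starRingEnd ℂ) (u : ℂ) ^ 2 * (τ : ℂ)‖⁻¹ ∂haarCircle := by
  have hτ : |τ| < 1 := by rw [abs_of_pos hτ0]; exact hτ1
  have hP := integral_poisson_haarCircle (r := τ) hτ0 hτ1
  have hle : ∫ u, (poisson ((starRingEnd ℂ) (u : ℂ) ^ 2 * (τ : ℂ)) + 1) / 2 ∂haarCircle ≤
      ∫ u, ‖(1 : ℂ) - (starRingEnd ℂ) (u : ℂ) ^ 2 * (τ : ℂ)‖⁻¹ ∂haarCircle := by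
    refine integral_mono ?_ ?_ fun u => poisson_add_one_div_two_le (conj_sq_mul_mem_ball u hτ)
    · exact (((continuous_poisson_conj_sq_mul hτ).add continuous_const).div_const 2).integrable_of_hasCompactSupport
        (HasCompactSupport.of_compactSpace _)
    · exact (continuous_norm_one_sub_inv hτ).integrable_of_hasCompactSupport
        (HasCompactSupport.of_compactSpace _)
  have hint : Integrable (fun u : Circle => poisson ((starRingEnd ℂ) (u : ℂ) ^ 2 * (τ : ℂ)))
      haarCircle :=
    (continuous_poisson_conj_sq_mul hτ).integrable_of_hasCompactSupport
      (HasCompactSupport.of_compactSpace _)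
  rw [integral_div, integral_add hint (integrable_const _), hP, integral_const, measureReal_def,
    haarCircle_univ, ENNReal.toReal_one, one_smul] at hle
  linarith

/-- **`(cosh t)⁻¹ ≤ Ξ(a_t)`** for every `t`. -/
theorem inv_cosh_le_sph_one_hyp (t : ℝ) : (Real.cosh t)⁻¹ ≤ sph 1 (hyp t) := by
  -- reduce to `t ≥ 0` by evenness
  wlog ht : 0 ≤ t generalizing t
  · have := this (-t) (by linarith)
    rwa [Real.cosh_neg, sph_hyp_neg] at this
  rcases ht.lt_or_eq with ht' | rfl
  · have hc : 0 < Real.cosh t := Real.cosh_pos t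
    have hτ0 : 0 < Real.tanh t := by
      rw [Real.tanh_eq_sinh_div_cosh]
      exact div_pos (Real.sinh_pos_iff.mpr ht') hc
    have hτ1 : Real.tanh t < 1 := Real.tanh_lt_one t
    have hτ : |Real.tanh t| < 1 := by rw [abs_of_pos hτ0]; exact hτ1
    rw [sph_hyp]
    have e : ∀ u : Circle,
        ‖(Real.cosh t : ℂ) - (starRingEnd ℂ) (u : ℂ) ^ 2 * Real.sinh t‖ ^ (-(1 : ℝ)) =
          (Real.cosh t)⁻¹ * ‖(1 : ℂ) - (starRingEnd ℂ) (u : ℂ) ^ 2 * (Real.tanh t : ℂ)‖⁻¹ := by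
      intro u
      have hs : (Real.sinh t : ℂ) = (Real.cosh t : ℂ) * (Real.tanh t : ℂ) := by
        rw [← Complex.ofReal_mul, Real.tanh_eq_sinh_div_cosh, mul_div_cancel₀ _ hc.ne']
      rw [Real.rpow_neg_one, hs, show (Real.cosh t : ℂ) - (starRingEnd ℂ) (u : ℂ) ^ 2 *
          ((Real.cosh t : ℂ) * (Real.tanh t : ℂ)) =
          (Real.cosh t : ℂ) * ((1 : ℂ) - (starRingEnd ℂ) (u : ℂ) ^ 2 * (Real.tanh t : ℂ)) by ring,
        norm_mul, Complex.norm_real, Real.norm_eq_abs, abs_of_pos hc, mul_inv]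
    simp_rw [e]
    rw [integral_const_mul]
    calc (Real.cosh t)⁻¹ = (Real.cosh t)⁻¹ * 1 := (mul_one _).symm
      _ ≤ _ := mul_le_mul_of_nonneg_left (one_le_integral_norm_one_sub_inv hτ0 hτ1)
          (inv_nonneg.mpr hc.le)
  · rw [Real.cosh_zero, inv_one, hyp_zero, sph_one]

/-- **`|a(g)|⁻¹ ≤ Ξ(g)`** on the whole group (sharpening the `2 |a(g)|⁻¹ ≤ 2 Ξ(g)` of row 243). -/
theorem norm_mat_inv_le_sph_one (g : SU11) : ‖mat g 0 0‖⁻¹ ≤ sph 1 g := by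
  rw [← cosh_cartanT, sph_eq_sph_hyp_cartanT]
  exact inv_cosh_le_sph_one_hyp _

/-- **`|a(g)|⁻¹ ≤ φ_λ(g)`** for every `λ` (`Ξ ≤ φ_λ`). -/
theorem norm_mat_inv_le_sph (lam : ℝ) (g : SU11) : ‖mat g 0 0‖⁻¹ ≤ sph lam g :=
  (norm_mat_inv_le_sph_one g).trans (sph_one_le lam g)

/-- **`|a(g)|^{-s} ≤ Ξ(g)` for every `s ≥ 1`.** -/
theorem norm_mat_inv_rpow_le_sph_one {s : ℝ} (hs : 1 ≤ s) (g : SU11) :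
    ‖mat g 0 0‖⁻¹ ^ s ≤ sph 1 g := by
  have h0 : 0 < ‖mat g 0 0‖⁻¹ := by
    rw [← cosh_cartanT]
    exact inv_pos.mpr (Real.cosh_pos _)
  have h1 : ‖mat g 0 0‖⁻¹ ≤ 1 := by
    rw [← cosh_cartanT]
    exact inv_le_one_of_one_le₀ (Real.one_le_cosh _)
  calc ‖mat g 0 0‖⁻¹ ^ s ≤ ‖mat g 0 0‖⁻¹ ^ (1 : ℝ) :=
        Real.rpow_le_rpow_of_exponent_ge h0 h1 hs
    _ = ‖mat g 0 0‖⁻¹ := Real.rpow_one _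
    _ ≤ sph 1 g := norm_mat_inv_le_sph_one g

/-- **The Herz–Cowling–Haagerup–Howe majorant for the weight-`s` discrete-series coefficients**:
`(1 − |g·0|²)^{s/2} ≤ Ξ(g)` for every `s ≥ 1`. -/
theorem one_sub_norm_orbit_sq_rpow_le_sph_one {s : ℝ} (hs : 1 ≤ s) (g : SU11) :
    (1 - ‖orbit g‖ ^ 2) ^ (s / 2) ≤ sph 1 g := by
  have h0 : 0 ≤ ‖mat g 0 0‖⁻¹ := inv_nonneg.mpr (norm_nonneg _)
  rw [← inv_cosh_cartanT_sq, cosh_cartanT, ← Real.rpow_natCast, ← Real.rpow_mul h0,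
    show ((2 : ℕ) : ℝ) * (s / 2) = s by push_cast; ring]
  exact norm_mat_inv_rpow_le_sph_one hs g

end measure

end Summit.Ventures.HodgeRepro2.T5SU11SphericalMajorant
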